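import Literature.InformationTheory.QuantumCodes.HypergraphProductSectorDistances
import Literature.InformationTheory.QuantumCodes.HypergraphProductParameters
import Literature.InformationTheory.QuantumCodes.CSSParameters
import HarnessLib

/-!
# Sector distances of the hypergraph product EXACTLY — Zeng–Pryadko's Künneth formula (Thm 17), both halves

For Tillich–Zémor's quantum code `Q_ℋ`, `ℋ = ℋ₁·ℋ₂` (`H_X = xMatrix H₁ H₂ = [H₁ ⊗ 1 | 1 ⊗ H₂]`,
`H_Z = zMatrix H₁ H₂ = [1 ⊗ H₂ᵀ | H₁ᵀ ⊗ 1]`, `Literature/InformationTheory/QuantumCodes/HypergraphProduct.lean`,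
[TillichZemor2014]) read as the tensor product of the two-term complexes `𝒜 : 𝔽₂^{E₁} →(H₁) 𝔽₂^{V₁}` and
`ℬ : 𝔽₂^{E₂} →(H₂) 𝔽₂^{V₂}`, Zeng–Pryadko's Theorem 17 [ZengPryadko2020, chunk p0018 L1-12: "the homological distance
at level `j` of the product complex is `d_j(𝒞) = min_i d_i(𝒜) d_{j−i}(ℬ)`" when one factor has two non-trivial spaces]
gives, at level `1` and with `d₁(𝒜) = d(ker H₁)`, `d₀(𝒜) ∈ {1, ∞}` (`= 1` iff `coker H₁ = 𝔽₂^{V₁} / im H₁ ≠ 0` iff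
`ker H₁ᵀ ≠ 0`, `= ∞` otherwise — the paper's convention that a trivial homology group has infinite distance),
the SECTOR distances of the tree's `CSSParameters.lean` as EQUALITIES:

* `cssDistZ_xMatrix_eq` — `d_Z(Q_ℋ) = min( d(ker H₁)·[ker H₂ᵀ ≠ 0], [ker H₁ᵀ ≠ 0]·d(ker H₂) )` (cycles modulo
  chambers), the bracket written as the guard `⨅ (_ : pcCode Hᵀ ≠ ⊥), …` (`= ⊤` when the guard fails);
* `cssDistX_xMatrix_eq` — `d_X(Q_ℋ) = min( d(ker H₁ᵀ)·[ker H₂ ≠ 0], [ker H₁ ≠ 0]·d(ker H₂ᵀ) )` (cocycles modulo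
  elementary cocycles), by Poincaré duality (`cssDistX_xMatrix_eq_cssDistZ_transpose`, TZ Prop. 2);
* `cssMinDist_xMatrix_eq` — the CSS minimum distance of every `Q_{ℋ₁·ℋ₂}` in closed form (`D = min(d_X, d_Z)`),
  which contains Tillich–Zémor's Theorem 9 (`≥ min(d₁,d₂,d₁ᵀ,d₂ᵀ)`) and Lemma 10 and decides every degenerate case.

The LOWER-BOUND half is `HypergraphProductSectorDistances.lean` (qec-type-04: `cycle_weight_ge`,
`cycle_weight_ge_of_transpose`, cocycle versions), restated here for `cssDistZ`/`cssDistX` and completed by the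
missing regime `ker H₂ᵀ = 0 ⇒ d_Z ≥ d(ker H₂)` through the FACTOR SWAP `ℋ₂·ℋ₁ ≅ ℋ₁·ℋ₂` (`xMatrix_swap_factors`,
`zMatrix_swap_factors`: relabel rows and qubits along explicit equivalences; it preserves the sectors, unlike Poincaré duality which exchanges
them) and by `cssDistZ_xMatrix_eq_top` (`ker H₁ᵀ = ker H₂ᵀ = 0 ⇒` every cycle is a sum of chambers: two right
inverses). The UPPER-BOUND half is Zeng–Pryadko's Statement 14 [ZengPryadko2020, chunk p0016 L23-72] = the explicit
cycles `(c ⊗ e_y, 0)`, `(0, e_x ⊗ c)` of Tillich–Zémor's Lemma 10 (`witness₁_*`, `witness₂_*` of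
`HypergraphProductParameters.lean`), re-targeted at the sector distance. General reindexing lemmas for
`cssDistX`/`cssDistZ` (rows AND qubits) come first. Everything is over `𝔽₂ = ZMod 2`; the file is def-free.

Dictionary for `HGP(A,B) = Q_{ℋ_A·ℋ_Bᵀ}` (`Summits/Ventures/QEC/Basic/HypergraphProduct.lean`): `H₁ = A`, `H₂ = Bᵀ`, so
`d_Z(HGP(A,B)) = min(d_A·[k_B ≥ 1], d_Bᵀ·[k_Aᵀ ≥ 1])` and `d_X(HGP(A,B)) = min(d_Aᵀ·[k_Bᵀ ≥ 1], d_B·[k_A ≥ 1])`.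

LADDER-QEC (venture cell `qec`): PARTITION item 04.HGPK2, upper half, written by qec-search-4 on qec-type-04's offer
(HOME/INBOX 2026-08-26T22:57:22Z) and the director's word (R9 (3), 23:55:37Z). HONEST FRAMING: theorems about all pairs
of binary matrices; no census row needs them (rows use the regimes of `Basic/HypergraphProductCensus.lean` /
`Basic/HypergraphProductSector.lean`); they make the Literature statement of [ZengPryadko2020, Thm 17] complete for
length-two complexes over `𝔽₂`.

References: [ZengPryadko2020] W. Zeng, L. P. Pryadko, *Minimal distances for certain quantum product codes and
tensor products of chain complexes*, Phys. Rev. A 102, 062402 (2020) = arXiv:2007.12152 ("Künneth theorem with a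
distance"), Thm 17 (chunk p0018 L1-12), Statement 14 (chunk p0016 L23-72); [TillichZemor2014] J.-P. Tillich, G. Zémor,
IEEE Trans. IT 60 (2014) 1193 = arXiv:0903.0566v1, Prop. 2 (chunk p0006 L95-110), Thm 9 (p0008 L11-15), Lemma 10
(p0008 L53-95).
-/

namespace Literature.InformationTheory.QuantumCodes

open Matrix Module
open scoped Kronecker
open Literature.InformationTheory.Coding (minDist minDist_bot minDist_le_hammingNorm le_minDist_iff)

/-! ### Reindexing rows and qubits: sector distances -/

section Reindex

variable {r r' r₂ r₂' q q' : Type*} [Fintype r] [Fintype r'] [Fintype r₂] [Fintype r₂'] [Fintype q] [Fintype q']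

omit [Fintype r] [Fintype r₂] in
/-- Membership in the code of a matrix with rows relabelled along an equivalence and qubits along another:
`e ∈ ker (A.submatrix ρ σ) ↔ e ∘ σ⁻¹ ∈ ker A`.
[cite: TillichZemor2014, §2 and Prop. 2 (arXiv v1 chunks p0004 L9-18, p0006 L95-100: relabelled check / edge sets are identified)] -/
theorem mem_pcCode_submatrix_equiv_iff (A : Matrix r q (ZMod 2)) (ρ : r₂ ≃ r) (σ : q' ≃ q) (e : q' → ZMod 2) :
    e ∈ pcCode (A.submatrix ρ σ) ↔ e ∘ σ.symm ∈ pcCode A := by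
  rw [show A.submatrix ρ σ = (A.submatrix ρ id).submatrix id σ from rfl, mem_pcCode_submatrix_iff,
    pcCode_submatrix_equiv_rows]

omit [Fintype q] [Fintype q'] in
/-- Membership in the row space of a matrix with rows and qubits relabelled along equivalences:
`e ∈ rs (A.submatrix ρ σ) ↔ e ∘ σ⁻¹ ∈ rs A`.
[cite: TillichZemor2014, §2 and Prop. 2 (arXiv v1 chunks p0004 L9-18, p0006 L95-100)] -/
theorem mem_rowSpace_submatrix_equiv_iff (A : Matrix r q (ZMod 2)) (ρ : r₂ ≃ r) (σ : q' ≃ q) (e : q' → ZMod 2) :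
    e ∈ rowSpace (A.submatrix ρ σ) ↔ e ∘ σ.symm ∈ rowSpace A := by
  rw [show A.submatrix ρ σ = (A.submatrix ρ id).submatrix id σ from rfl, mem_rowSpace_submatrix_iff,
    rowSpace_submatrix_equiv_rows]

omit [Fintype r'] [Fintype r₂'] in
/-- The `X`-distance is unchanged by relabelling the rows of the two check matrices and the qubits.
[cite: BravyiEtAl2024, §4 proof of Lemma 1 (arXiv chunk p0009 L115)]
[cite: TillichZemor2014, Prop. 2 (arXiv v1 chunk p0006 L95-100)] -/
theorem cssDistX_submatrix_equiv (A : Matrix r q (ZMod 2)) (B : Matrix r' q (ZMod 2)) (ρ : r₂ ≃ r) (ρ' : r₂' ≃ r')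
    (σ : q' ≃ q) : cssDistX (A.submatrix ρ σ) (B.submatrix ρ' σ) = cssDistX A B := by
  refine le_antisymm (le_cssDistX_iff.2 fun v hv => ?_) (le_cssDistX_iff.2 fun v hv => ?_)
  · -- a logical `v` for `(A, B)` pulls back to the logical `v ∘ σ`
    have h' : (v ∘ σ) ∘ σ.symm = v := by
      ext j
      simp
    have hv' : (v ∘ σ) ∈ pcCode (B.submatrix ρ' σ) ∧ (v ∘ σ) ∉ rowSpace (A.submatrix ρ σ) := by
      rw [mem_pcCode_submatrix_equiv_iff, mem_rowSpace_submatrix_equiv_iff, h']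
      exact hv
    refine (cssDistX_le_hammingNorm hv').trans (le_of_eq ?_)
    have h := hammingNorm_comp_equiv (v ∘ σ) σ
    rw [h'] at h
    exact_mod_cast h.symm
  · have hv' : (v ∘ σ.symm) ∈ pcCode B ∧ (v ∘ σ.symm) ∉ rowSpace A := by
      rw [← mem_pcCode_submatrix_equiv_iff B ρ' σ, ← mem_rowSpace_submatrix_equiv_iff A ρ σ]
      exact hv
    refine (cssDistX_le_hammingNorm hv').trans (le_of_eq ?_)
    exact_mod_cast hammingNorm_comp_equiv v σ

omit [Fintype r] [Fintype r₂] in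
/-- The `Z`-distance is unchanged by relabelling rows and qubits.
[cite: BravyiEtAl2024, §4 proof of Lemma 1 (arXiv chunk p0009 L117)]
[cite: TillichZemor2014, Prop. 2 (arXiv v1 chunk p0006 L95-100)] -/
theorem cssDistZ_submatrix_equiv (A : Matrix r q (ZMod 2)) (B : Matrix r' q (ZMod 2)) (ρ : r₂ ≃ r) (ρ' : r₂' ≃ r')
    (σ : q' ≃ q) : cssDistZ (A.submatrix ρ σ) (B.submatrix ρ' σ) = cssDistZ A B :=
  cssDistX_submatrix_equiv B A ρ' ρ σ

end Reindex

namespace HypergraphProduct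

variable {V₁ E₁ V₂ E₂ : Type*}
variable [Fintype V₁] [Fintype E₁] [Fintype V₂] [Fintype E₂]
variable [DecidableEq V₁] [DecidableEq E₁] [DecidableEq V₂] [DecidableEq E₂]

/-! ### Exchanging the two factors: `ℋ₂·ℋ₁ ≅ ℋ₁·ℋ₂` (sectors preserved) -/

omit [Fintype V₁] [Fintype E₁] [Fintype V₂] [Fintype E₂] [DecidableEq E₁] [DecidableEq E₂] in
/-- **Factor swap, `H_X`:** the vertex–edge incidence matrix of `ℋ₂·ℋ₁` is that of `ℋ₁·ℋ₂` with vertices `ba ↦ ab`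
and edges relabelled `βa ↦ aβ` (`E_R` of the one is `E_L` of the other), `bα ↦ αb` — the equivalence
`(E₂ × V₁) ⊕ (V₂ × E₁) ≃ (E₁ × V₂) ⊕ (V₁ × E₂)` written with `Equiv.prodComm` / `Equiv.sumComm`. Proved (entrywise).
[cite: TillichZemor2014, §3 (arXiv v1 chunk p0006 L56-74: the two edge types `E_R`, `E_L`)] -/
theorem xMatrix_swap_factors (H₁ : Matrix V₁ E₁ (ZMod 2)) (H₂ : Matrix V₂ E₂ (ZMod 2)) :
    xMatrix H₂ H₁ = (xMatrix H₁ H₂).submatrix (Equiv.prodComm V₂ V₁)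
      ((Equiv.sumCongr (Equiv.prodComm E₂ V₁) (Equiv.prodComm V₂ E₁)).trans (Equiv.sumComm _ _)) := by
  ext ⟨b, a⟩ (⟨β, a'⟩ | ⟨b', α⟩)
  · show xMatrix H₂ H₁ (b, a) (Sum.inl (β, a')) = xMatrix H₁ H₂ (a, b) (Sum.inr (a', β))
    rw [xMatrix_apply_inl, xMatrix_apply_inr, mul_comm]
  · show xMatrix H₂ H₁ (b, a) (Sum.inr (b', α)) = xMatrix H₁ H₂ (a, b) (Sum.inl (α, b'))
    rw [xMatrix_apply_inr, xMatrix_apply_inl, mul_comm]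

omit [Fintype V₁] [Fintype E₁] [Fintype V₂] [Fintype E₂] [DecidableEq V₁] [DecidableEq V₂] in
/-- **Factor swap, `H_Z`:** the chamber–edge incidence matrix of `ℋ₂·ℋ₁` is that of `ℋ₁·ℋ₂` with chambers `βα ↦ αβ`
and the same relabelling of the edges. Proved (entrywise). [cite: TillichZemor2014, §3 (arXiv v1 chunk p0006 L82-90)] -/
theorem zMatrix_swap_factors (H₁ : Matrix V₁ E₁ (ZMod 2)) (H₂ : Matrix V₂ E₂ (ZMod 2)) :
    zMatrix H₂ H₁ = (zMatrix H₁ H₂).submatrix (Equiv.prodComm E₂ E₁)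
      ((Equiv.sumCongr (Equiv.prodComm E₂ V₁) (Equiv.prodComm V₂ E₁)).trans (Equiv.sumComm _ _)) := by
  ext ⟨β, α⟩ (⟨β', a⟩ | ⟨b, α'⟩)
  · show zMatrix H₂ H₁ (β, α) (Sum.inl (β', a)) = zMatrix H₁ H₂ (α, β) (Sum.inr (a, β'))
    rw [zMatrix_apply_inl, zMatrix_apply_inr, mul_comm]
  · show zMatrix H₂ H₁ (β, α) (Sum.inr (b, α')) = zMatrix H₁ H₂ (α, β) (Sum.inl (α', b))
    rw [zMatrix_apply_inr, zMatrix_apply_inl, mul_comm]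

/-- Exchanging the factors does not change the `Z`-distance (cycles go to cycles, chambers to chambers).
[cite: ZengPryadko2020, Thm 17 (chunk p0018 L1-12: the formula is symmetric in `𝒜`, `ℬ`)] -/
theorem cssDistZ_swap_factors (H₁ : Matrix V₁ E₁ (ZMod 2)) (H₂ : Matrix V₂ E₂ (ZMod 2)) :
    cssDistZ (xMatrix H₂ H₁) (zMatrix H₂ H₁) = cssDistZ (xMatrix H₁ H₂) (zMatrix H₁ H₂) := by
  rw [xMatrix_swap_factors, zMatrix_swap_factors]
  exact cssDistZ_submatrix_equiv _ _ _ _ _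

/-- Exchanging the factors does not change the `X`-distance.
[cite: ZengPryadko2020, Thm 17 (chunk p0018 L1-12)] -/
theorem cssDistX_swap_factors (H₁ : Matrix V₁ E₁ (ZMod 2)) (H₂ : Matrix V₂ E₂ (ZMod 2)) :
    cssDistX (xMatrix H₂ H₁) (zMatrix H₂ H₁) = cssDistX (xMatrix H₁ H₂) (zMatrix H₁ H₂) := by
  rw [xMatrix_swap_factors, zMatrix_swap_factors]
  exact cssDistX_submatrix_equiv _ _ _ _ _

/-! ### `Z`-sector: upper bounds (Zeng–Pryadko Statement 14 = Tillich–Zémor's Lemma 10 witnesses) -/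

/-- **`d_Z ≤ d(ker H₁)` when `ker H₂ᵀ ≠ 0`** (`d₀(ℬ) = 1`): for a minimum-weight cycle `c` of `ℋ₁` and a vertex `y`
of `ℋ₂` with `e_y ∉ im H₂`, the cycle `(c ⊗ e_y, 0)` of `ℋ` has weight `d(ker H₁)` and is not a sum of chambers.
(Trivial when `ker H₁ = 0`, `d(ker H₁) = ⊤`.) [cite: ZengPryadko2020, Statement 14 (chunk p0016 L23-72)]
[cite: TillichZemor2014, proof of Lemma 10 (arXiv v1 chunk p0008 L63-93)] -/
theorem cssDistZ_xMatrix_le_left (H₁ : Matrix V₁ E₁ (ZMod 2)) (H₂ : Matrix V₂ E₂ (ZMod 2))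
    (h : pcCode H₂ᵀ ≠ ⊥) : cssDistZ (xMatrix H₁ H₂) (zMatrix H₁ H₂) ≤ minDist (pcCode H₁) := by
  by_cases hd : minDist (pcCode H₁) < ⊤
  · obtain ⟨c, hc, hc0, hcw⟩ := exists_hammingNorm_eq_minDist _ hd
    obtain ⟨y, hy⟩ := exists_single_notMem_rowSpace H₂ h
    rw [cssDistZ_eq_cssDistX_swap, ← hcw, ← hammingNorm_witness₁ (V₁ := V₁) (E₂ := E₂) c y]
    exact cssDistX_le_hammingNorm ⟨witness₁_mem H₁ H₂ hc y, witness₁_notMem H₁ H₂ hc0 hy⟩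
  · rw [not_lt_top_iff] at hd
    rw [hd]
    exact le_top

/-- **`d_Z ≤ d(ker H₂)` when `ker H₁ᵀ ≠ 0`** (`d₀(𝒜) = 1`): the cycle `(0, e_x ⊗ c)` for a minimum-weight cycle `c`
of `ℋ₂` and a vertex `x` of `ℋ₁` with `e_x ∉ im H₁`. [cite: ZengPryadko2020, Statement 14 (chunk p0016 L23-72)]
[cite: TillichZemor2014, proof of Lemma 10 (arXiv v1 chunk p0008 L94-95)] -/
theorem cssDistZ_xMatrix_le_right (H₁ : Matrix V₁ E₁ (ZMod 2)) (H₂ : Matrix V₂ E₂ (ZMod 2))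
    (h : pcCode H₁ᵀ ≠ ⊥) : cssDistZ (xMatrix H₁ H₂) (zMatrix H₁ H₂) ≤ minDist (pcCode H₂) := by
  by_cases hd : minDist (pcCode H₂) < ⊤
  · obtain ⟨c, hc, hc0, hcw⟩ := exists_hammingNorm_eq_minDist _ hd
    obtain ⟨x, hx⟩ := exists_single_notMem_rowSpace H₁ h
    rw [cssDistZ_eq_cssDistX_swap, ← hcw, ← hammingNorm_witness₂ (E₁ := E₁) (V₂ := V₂) c x]
    exact cssDistX_le_hammingNorm ⟨witness₂_mem H₁ H₂ hc x, witness₂_notMem H₁ H₂ hc0 hx⟩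
  · rw [not_lt_top_iff] at hd
    rw [hd]
    exact le_top

/-! ### `Z`-sector: lower bounds (restated from `HypergraphProductSectorDistances`) and the missing regime -/

/-- **`d_Z ≥ min(d(ker H₁), d(ker H₂))`** — `cycle_weight_ge` stated for `cssDistZ`.
[cite: ZengPryadko2020, Thm 17 (chunk p0018 L1-12)] -/
theorem le_cssDistZ_xMatrix (H₁ : Matrix V₁ E₁ (ZMod 2)) (H₂ : Matrix V₂ E₂ (ZMod 2)) :
    min (minDist (pcCode H₁)) (minDist (pcCode H₂)) ≤ cssDistZ (xMatrix H₁ H₂) (zMatrix H₁ H₂) := by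
  rw [cssDistZ_eq_cssDistX_swap]
  exact le_cssDistX_iff.2 fun _ he => cycle_weight_ge H₁ H₂ he.1 he.2

/-- **`ker H₁ᵀ = 0 ⇒ d_Z ≥ d(ker H₁)`** — `cycle_weight_ge_of_transpose` stated for `cssDistZ`.
[cite: ZengPryadko2020, Thm 17 (chunk p0018 L1-12), the term `d₀(𝒜)·d₁(ℬ)` being infinite] -/
theorem le_cssDistZ_xMatrix_of_transpose_left (H₁ : Matrix V₁ E₁ (ZMod 2)) (H₂ : Matrix V₂ E₂ (ZMod 2))
    (h1 : pcCode H₁ᵀ = ⊥) : minDist (pcCode H₁) ≤ cssDistZ (xMatrix H₁ H₂) (zMatrix H₁ H₂) := by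
  rw [cssDistZ_eq_cssDistX_swap]
  exact le_cssDistX_iff.2 fun _ he => cycle_weight_ge_of_transpose H₁ H₂ h1 he.1 he.2

/-- **`ker H₂ᵀ = 0 ⇒ d_Z ≥ d(ker H₂)`** (the regime symmetric to `le_cssDistZ_xMatrix_of_transpose_left`, obtained
from it by exchanging the factors): when the second factor has no homology in degree `0` the term
`d₁(𝒜)·d₀(ℬ)` of the Künneth minimum is infinite. [cite: ZengPryadko2020, Thm 17 (chunk p0018 L1-12)] -/
theorem le_cssDistZ_xMatrix_of_transpose_right (H₁ : Matrix V₁ E₁ (ZMod 2)) (H₂ : Matrix V₂ E₂ (ZMod 2))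
    (h2 : pcCode H₂ᵀ = ⊥) : minDist (pcCode H₂) ≤ cssDistZ (xMatrix H₁ H₂) (zMatrix H₁ H₂) := by
  rw [← cssDistZ_swap_factors]
  exact le_cssDistZ_xMatrix_of_transpose_left H₂ H₁ h2

/-! ### `Z`-sector: no logical operator when both factors are onto -/

omit [Fintype V₁] [Fintype E₁] [Fintype V₂] [Fintype E₂] [DecidableEq V₁] [DecidableEq E₁] [DecidableEq V₂]
  [DecidableEq E₂] in
/-- In characteristic two, `X + (M + X) = M` for matrices. [folklore] -/
private theorem add_add_cancel_mat {m n : Type*} (X M : Matrix m n (ZMod 2)) : X + (M + X) = M := by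
  ext i j
  simp only [Matrix.add_apply]
  generalize X i j = x
  generalize M i j = y
  revert x y
  decide

omit [Fintype V₁] [Fintype E₁] [Fintype V₂] [Fintype E₂] [DecidableEq V₁] [DecidableEq E₁] [DecidableEq V₂]
  [DecidableEq E₂] in
/-- In characteristic two, `X + X = 0` for matrices. [folklore] -/
private theorem add_self_mat {m n : Type*} (X : Matrix m n (ZMod 2)) : X + X = 0 := by
  ext i j
  simp only [Matrix.add_apply, Matrix.zero_apply]
  generalize X i j = x
  revert x
  decide

omit [Fintype V₂] [Fintype E₂] [DecidableEq V₂] [DecidableEq E₂] in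
/-- A parity-check matrix with zero transpose code is ONTO: it has a right inverse, `H R = 1`
(rank–nullity: `rank H = rank Hᵀ = |V|`). [cite: TillichZemor2014, §6 (arXiv v1 chunk p0009 L8-10: full rank means `dim Z(ℋᵀ) = 0`)] -/
theorem exists_mul_eq_one_of_pcCode_transpose_eq_bot (H : Matrix V₁ E₁ (ZMod 2)) (h : pcCode Hᵀ = ⊥) :
    ∃ R : Matrix E₁ V₁ (ZMod 2), H * R = 1 := by
  have hrange : LinearMap.range H.mulVecLin = ⊤ := by
    apply Submodule.eq_top_of_finrank_eq
    rw [Module.finrank_fintype_fun_eq_card]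
    have hr := rank_add_finrank_pcCode Hᵀ
    rw [h, finrank_bot, add_zero, Matrix.rank_transpose] at hr
    exact hr
  obtain ⟨g, hg⟩ := LinearMap.exists_rightInverse_of_surjective H.mulVecLin hrange
  refine ⟨LinearMap.toMatrix' g, ?_⟩
  have hc := congrArg LinearMap.toMatrix' hg
  rwa [← Matrix.toLin'_apply', LinearMap.toMatrix'_comp, LinearMap.toMatrix'_toLin',
    LinearMap.toMatrix'_id] at hc

/-- **Both factors onto ⇒ every cycle is a sum of chambers** (`ker H₁ᵀ = ker H₂ᵀ = 0`: the homology
`ker H₁ ⊗ coker H₂ ⊕ coker H₁ ⊗ ker H₂` of the product vanishes in degree one). Explicitly, for a cycle `(M, N)`,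
`H₁ M = N H₂ᵀ`, and right inverses `H₁R₁ = 1`, `H₂R₂ = 1`, the chamber coefficients
`G = R₁N + (M + R₁NH₂ᵀ)R₂ᵀ` satisfy `G H₂ᵀ = M`, `H₁ G = N`.
[cite: ZengPryadko2020, Thm 17 (chunk p0018 L1-12) with `d₀(𝒜) = d₀(ℬ) = ∞`] -/
theorem mem_rowSpace_zMatrix_of_transpose (H₁ : Matrix V₁ E₁ (ZMod 2)) (H₂ : Matrix V₂ E₂ (ZMod 2))
    (h1 : pcCode H₁ᵀ = ⊥) (h2 : pcCode H₂ᵀ = ⊥) {e : (E₁ × V₂) ⊕ (V₁ × E₂) → ZMod 2}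
    (he : e ∈ pcCode (xMatrix H₁ H₂)) : e ∈ rowSpace (zMatrix H₁ H₂) := by
  obtain ⟨R₁, hR₁⟩ := exists_mul_eq_one_of_pcCode_transpose_eq_bot H₁ h1
  obtain ⟨R₂, hR₂⟩ := exists_mul_eq_one_of_pcCode_transpose_eq_bot H₂ h2
  have hMN : H₁ * partR e = partL e * H₂ᵀ := by
    have h := (mem_pcCode_xMatrix_iff H₁ H₂ e).1 he
    rw [add_eq_zero_iff_eq_neg] at h
    rw [h]
    ext a b
    exact ZMod.neg_eq_self_mod_two _
  have hR₂' : R₂ᵀ * H₂ᵀ = 1 := by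
    rw [← Matrix.transpose_mul, hR₂, Matrix.transpose_one]
  rw [mem_rowSpace_zMatrix_iff]
  refine ⟨R₁ * partL e + (partR e + R₁ * (partL e * H₂ᵀ)) * R₂ᵀ, ?_, ?_⟩
  · rw [Matrix.add_mul, Matrix.mul_assoc (partR e + _), hR₂', Matrix.mul_one, Matrix.mul_assoc]
    exact (add_add_cancel_mat _ _).symm
  · rw [Matrix.mul_add, ← Matrix.mul_assoc, hR₁, Matrix.one_mul, ← Matrix.mul_assoc, Matrix.mul_add, hMN,
      ← Matrix.mul_assoc, ← Matrix.mul_assoc, hR₁, Matrix.one_mul, add_self_mat, Matrix.zero_mul, add_zero]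

/-- **`ker H₁ᵀ = ker H₂ᵀ = 0 ⇒ d_Z = ⊤`** (no `Z`-type logical operator: both Künneth terms are infinite).
[cite: ZengPryadko2020, Thm 17 (chunk p0018 L1-12)] [cite: TillichZemor2014, §5 (arXiv v1 chunk p0008 L3-4: distance `∞` of the zero code)] -/
theorem cssDistZ_xMatrix_eq_top (H₁ : Matrix V₁ E₁ (ZMod 2)) (H₂ : Matrix V₂ E₂ (ZMod 2))
    (h1 : pcCode H₁ᵀ = ⊥) (h2 : pcCode H₂ᵀ = ⊥) : cssDistZ (xMatrix H₁ H₂) (zMatrix H₁ H₂) = ⊤ := by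
  rw [cssDistZ_eq_cssDistX_swap]
  refine top_le_iff.1 (le_cssDistX_iff.2 fun _ he => ?_)
  exact absurd (mem_rowSpace_zMatrix_of_transpose H₁ H₂ h1 h2 he.1) he.2

/-! ### `Z`-sector: the exact formula -/

/-- **Zeng–Pryadko Theorem 17, `Z`-sector of `Q_{ℋ₁·ℋ₂}`, EXACT:**
`d_Z = min( d(ker H₁)·[ker H₂ᵀ ≠ 0], [ker H₁ᵀ ≠ 0]·d(ker H₂) )` — in Künneth terms
`d₁(𝒜×ℬ) = min(d₁(𝒜)d₀(ℬ), d₀(𝒜)d₁(ℬ))` with `d₀ ∈ {1, ∞}`; each guard `⨅ (_ : pcCode Hᵀ ≠ ⊥), d` reads "`d` if the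
coker is nonzero, `⊤` otherwise", and `d(0) = ⊤`. Assembled from the regime lemmas above.
[cite: ZengPryadko2020, Thm 17 (chunk p0018 L1-12) and Statement 14 (chunk p0016 L23-72)] -/
theorem cssDistZ_xMatrix_eq (H₁ : Matrix V₁ E₁ (ZMod 2)) (H₂ : Matrix V₂ E₂ (ZMod 2)) :
    cssDistZ (xMatrix H₁ H₂) (zMatrix H₁ H₂) =
      min (⨅ (_ : pcCode H₂ᵀ ≠ ⊥), minDist (pcCode H₁)) (⨅ (_ : pcCode H₁ᵀ ≠ ⊥), minDist (pcCode H₂)) := by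
  by_cases h1 : pcCode H₁ᵀ = ⊥ <;> by_cases h2 : pcCode H₂ᵀ = ⊥
  · rw [iInf_neg (fun h => h h2), iInf_neg (fun h => h h1), min_self]
    exact cssDistZ_xMatrix_eq_top H₁ H₂ h1 h2
  · rw [iInf_pos h2, iInf_neg (fun h => h h1), min_top_right]
    exact le_antisymm (cssDistZ_xMatrix_le_left H₁ H₂ h2) (le_cssDistZ_xMatrix_of_transpose_left H₁ H₂ h1)
  · rw [iInf_neg (fun h => h h2), iInf_pos h1, min_top_left]
    exact le_antisymm (cssDistZ_xMatrix_le_right H₁ H₂ h1) (le_cssDistZ_xMatrix_of_transpose_right H₁ H₂ h2)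
  · rw [iInf_pos h2, iInf_pos h1]
    exact le_antisymm (le_min (cssDistZ_xMatrix_le_left H₁ H₂ h2) (cssDistZ_xMatrix_le_right H₁ H₂ h1))
      (le_cssDistZ_xMatrix H₁ H₂)

/-! ### `X`-sector by Poincaré duality -/

/-- **Poincaré duality for the sectors** (TZ Prop. 2): the `X`-distance of `Q_{ℋ₁·ℋ₂}` is the `Z`-distance of
`Q_{ℋ₁ᵀ·ℋ₂ᵀ}` (cocycles of `ℋ` are the cycles of the dual product, after exchanging the two edge blocks).
[cite: TillichZemor2014, Prop. 2 and §4 (arXiv v1 chunks p0006 L95-110, p0007 L13-15)] -/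
theorem cssDistX_xMatrix_eq_cssDistZ_transpose (H₁ : Matrix V₁ E₁ (ZMod 2)) (H₂ : Matrix V₂ E₂ (ZMod 2)) :
    cssDistX (xMatrix H₁ H₂) (zMatrix H₁ H₂) = cssDistZ (xMatrix H₁ᵀ H₂ᵀ) (zMatrix H₁ᵀ H₂ᵀ) := by
  rw [zMatrix_eq_submatrix_swap H₁ H₂, xMatrix_eq_submatrix_swap H₁ H₂,
    show (Sum.swap : (E₁ × V₂) ⊕ (V₁ × E₂) → (V₁ × E₂) ⊕ (E₁ × V₂)) = swapEquiv V₁ E₁ V₂ E₂ from rfl,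
    cssDistZ_eq_cssDistX_swap]
  exact cssDistX_submatrix_equiv _ _ (Equiv.refl _) (Equiv.refl _) (swapEquiv V₁ E₁ V₂ E₂)

/-- **`d_X ≤ d(ker H₁ᵀ)` when `ker H₂ ≠ 0`.** [cite: ZengPryadko2020, Statement 14 (chunk p0016 L23-72), for the co-chain complex] -/
theorem cssDistX_xMatrix_le_left (H₁ : Matrix V₁ E₁ (ZMod 2)) (H₂ : Matrix V₂ E₂ (ZMod 2))
    (h : pcCode H₂ ≠ ⊥) : cssDistX (xMatrix H₁ H₂) (zMatrix H₁ H₂) ≤ minDist (pcCode H₁ᵀ) := by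
  rw [cssDistX_xMatrix_eq_cssDistZ_transpose]
  exact cssDistZ_xMatrix_le_left H₁ᵀ H₂ᵀ (by rwa [Matrix.transpose_transpose])

/-- **`d_X ≤ d(ker H₂ᵀ)` when `ker H₁ ≠ 0`.** [cite: ZengPryadko2020, Statement 14 (chunk p0016 L23-72), for the co-chain complex] -/
theorem cssDistX_xMatrix_le_right (H₁ : Matrix V₁ E₁ (ZMod 2)) (H₂ : Matrix V₂ E₂ (ZMod 2))
    (h : pcCode H₁ ≠ ⊥) : cssDistX (xMatrix H₁ H₂) (zMatrix H₁ H₂) ≤ minDist (pcCode H₂ᵀ) := by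
  rw [cssDistX_xMatrix_eq_cssDistZ_transpose]
  exact cssDistZ_xMatrix_le_right H₁ᵀ H₂ᵀ (by rwa [Matrix.transpose_transpose])

/-- **`d_X ≥ min(d(ker H₁ᵀ), d(ker H₂ᵀ))`** — `cocycle_weight_ge` stated for `cssDistX`.
[cite: ZengPryadko2020, Thm 17 (chunk p0018 L1-12), applied to the co-chain complex] -/
theorem le_cssDistX_xMatrix (H₁ : Matrix V₁ E₁ (ZMod 2)) (H₂ : Matrix V₂ E₂ (ZMod 2)) :
    min (minDist (pcCode H₁ᵀ)) (minDist (pcCode H₂ᵀ)) ≤ cssDistX (xMatrix H₁ H₂) (zMatrix H₁ H₂) :=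
  le_cssDistX_iff.2 fun _ he => cocycle_weight_ge H₁ H₂ he.1 he.2

/-- **`ker H₁ = 0 ⇒ d_X ≥ d(ker H₁ᵀ)`** — `cocycle_weight_ge_of_kernel` stated for `cssDistX`.
[cite: ZengPryadko2020, Thm 17 (chunk p0018 L1-12)] -/
theorem le_cssDistX_xMatrix_of_kernel_left (H₁ : Matrix V₁ E₁ (ZMod 2)) (H₂ : Matrix V₂ E₂ (ZMod 2))
    (h1 : pcCode H₁ = ⊥) : minDist (pcCode H₁ᵀ) ≤ cssDistX (xMatrix H₁ H₂) (zMatrix H₁ H₂) :=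
  le_cssDistX_iff.2 fun _ he => cocycle_weight_ge_of_kernel H₁ H₂ h1 he.1 he.2

/-- **`ker H₂ = 0 ⇒ d_X ≥ d(ker H₂ᵀ)`** (the symmetric regime, by the factor swap).
[cite: ZengPryadko2020, Thm 17 (chunk p0018 L1-12)] -/
theorem le_cssDistX_xMatrix_of_kernel_right (H₁ : Matrix V₁ E₁ (ZMod 2)) (H₂ : Matrix V₂ E₂ (ZMod 2))
    (h2 : pcCode H₂ = ⊥) : minDist (pcCode H₂ᵀ) ≤ cssDistX (xMatrix H₁ H₂) (zMatrix H₁ H₂) := by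
  rw [← cssDistX_swap_factors]
  exact le_cssDistX_xMatrix_of_kernel_left H₂ H₁ h2

/-- **`ker H₁ = ker H₂ = 0 ⇒ d_X = ⊤`** (no `X`-type logical operator). [cite: ZengPryadko2020, Thm 17 (chunk p0018 L1-12)]
[cite: TillichZemor2014, §5 (arXiv v1 chunk p0008 L3-4)] -/
theorem cssDistX_xMatrix_eq_top (H₁ : Matrix V₁ E₁ (ZMod 2)) (H₂ : Matrix V₂ E₂ (ZMod 2))
    (h1 : pcCode H₁ = ⊥) (h2 : pcCode H₂ = ⊥) : cssDistX (xMatrix H₁ H₂) (zMatrix H₁ H₂) = ⊤ := by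
  rw [cssDistX_xMatrix_eq_cssDistZ_transpose]
  exact cssDistZ_xMatrix_eq_top H₁ᵀ H₂ᵀ (by rwa [Matrix.transpose_transpose])
    (by rwa [Matrix.transpose_transpose])

/-- **Zeng–Pryadko Theorem 17, `X`-sector of `Q_{ℋ₁·ℋ₂}`, EXACT:**
`d_X = min( d(ker H₁ᵀ)·[ker H₂ ≠ 0], [ker H₁ ≠ 0]·d(ker H₂ᵀ) )` (the co-chain complex: `d¹ = min(d¹(𝒜)d⁰(ℬ), d⁰(𝒜)d¹(ℬ))`
with `d¹(𝒜) = d(ker H₁ᵀ)`, `d⁰(𝒜) = 1` iff `ker H₁ ≠ 0`). [cite: ZengPryadko2020, Thm 17 (chunk p0018 L1-12) and Statement 14 (chunk p0016 L23-72)]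
[cite: TillichZemor2014, Prop. 2 (arXiv v1 chunk p0006 L95-110)] -/
theorem cssDistX_xMatrix_eq (H₁ : Matrix V₁ E₁ (ZMod 2)) (H₂ : Matrix V₂ E₂ (ZMod 2)) :
    cssDistX (xMatrix H₁ H₂) (zMatrix H₁ H₂) =
      min (⨅ (_ : pcCode H₂ ≠ ⊥), minDist (pcCode H₁ᵀ)) (⨅ (_ : pcCode H₁ ≠ ⊥), minDist (pcCode H₂ᵀ)) := by
  rw [cssDistX_xMatrix_eq_cssDistZ_transpose, cssDistZ_xMatrix_eq, Matrix.transpose_transpose,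
    Matrix.transpose_transpose]

/-! ### The minimum distance of every `Q_{ℋ₁·ℋ₂}` in closed form -/

/-- **The CSS minimum distance of the hypergraph product, EXACT, for every pair of binary matrices:**
`D(Q_{ℋ₁·ℋ₂}) = min(d_X, d_Z)` with the two sector formulas of Zeng–Pryadko's Theorem 17 substituted. Contains
Tillich–Zémor's Theorem 9 (`D ≥ min(d₁, d₂, d₁ᵀ, d₂ᵀ)`, all guards dropped) and Lemma 10 (the finite guards), and
decides the degenerate cases they leave open (e.g. one factor of full rank).
[cite: ZengPryadko2020, Thm 17 (chunk p0018 L1-12)] [cite: TillichZemor2014, Thm 9 and Lemma 10 (arXiv v1 chunk p0008 L11-15, L53-62)] -/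
theorem cssMinDist_xMatrix_eq (H₁ : Matrix V₁ E₁ (ZMod 2)) (H₂ : Matrix V₂ E₂ (ZMod 2)) :
    cssMinDist (xMatrix H₁ H₂) (zMatrix H₁ H₂) =
      min (min (⨅ (_ : pcCode H₂ ≠ ⊥), minDist (pcCode H₁ᵀ)) (⨅ (_ : pcCode H₁ ≠ ⊥), minDist (pcCode H₂ᵀ)))
          (min (⨅ (_ : pcCode H₂ᵀ ≠ ⊥), minDist (pcCode H₁)) (⨅ (_ : pcCode H₁ᵀ ≠ ⊥), minDist (pcCode H₂))) := by
  rw [cssMinDist_eq_min_cssDistX_cssDistZ, cssDistX_xMatrix_eq, cssDistZ_xMatrix_eq]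

end HypergraphProduct

end Literature.InformationTheory.QuantumCodes
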